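import Mathlib
import Summits.Ventures.PercRepro2.KPrimeBernsteinStep
import Summits.Ventures.PercRepro2.KPrimeInduction

/-!
# The edge induction for `(K′)` from the one-edge Bernstein condition (blind cell PercRepro2,
mine-c g42; `conjectures/MINE-C.md` §51.2)

`KPrimeBernsteinStep.lean` splits the cleared `(K′)` form along any edge `e` as
`(1 − t)³ F₀ + t (1 − t)² G₁ + t² (1 − t) G₂ + t³ F₁` and shows that `(K′)` at `p` follows from
`(K′)` at the two resolved weight vectors `p[e ↦ 0]`, `p[e ↦ 1]` once the two mixed-world forms
`G₁, G₂` are non-negative (`BernsteinStepHolds`).  Here the frame is closed: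

* **base case** (`kprimeHolds_of_pinned`): a PINNED weight vector (every weight `0` or `1`) is a
  point mass at `oneConfig p`, every mass is `0` or `1`, and `(K′)` is a Boolean case split — on
  `v ∈ C₁` the lean's masses `P(N) = P(X ∩ N) = 0` kill the form, on `v ∉ C₁` the form is
  `[S] [Ω] [y ∈ C₁] ([b ∈ C₁ ∪ C(v)] − [b ∈ C₁]) ≥ 0`;
* **induction** (`kprime_of_bernsteinStep_all`): if `BernsteinStepHolds` holds at every edge of
  every admissible weight vector, then `(K′)` holds for every admissible weight vector — by strong
  induction on the number of unresolved edges (`unres`, `KPrimeInduction.lean`), resolving ANY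
  unresolved edge.

So the lemma of record reduces, in the kernel, to the WEIGHT-FREE one-edge condition of §51
(`0 ≤ mixedOne`, `0 ≤ mixedTwo` — the two middle tensor-Bernstein coefficients), which the census
of §51.0 finds non-negative on every marked graph tested; the condition is not proved here.
-/

namespace Summit.Ventures.PercRepro2

namespace KPrime

variable {V : Type*} {E : Type*} [Fintype E] [DecidableEq E] [DecidableEq V]
  {R : Type*} [Field R] [LinearOrder R] [IsStrictOrderedRing R]

/-! ## Pinned weight vectors are point masses -/

section Pinned

/-- A pinned weight vector: every weight is `0` or `1`. -/
def Pinned (p : E → R) : Prop := ∀ e, p e = 0 ∨ p e = 1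

omit [Fintype E] [DecidableEq E] [IsStrictOrderedRing R] in
/-- The Bernoulli factor of a pinned weight is the indicator of the pinned state. -/
lemma edgeFactor_of_pinned {q : R} (hq : q = 0 ∨ q = 1) (c : Bool) :
    edgeFactor q c = if c = decide (q = 1) then 1 else 0 := by
  rcases hq with rfl | rfl <;> cases c <;> simp [edgeFactor]

omit [DecidableEq E] [IsStrictOrderedRing R] in
/-- The weight of a pinned vector is the point mass at `oneConfig p`. -/
lemma weight_of_pinned {p : E → R} (hp : Pinned p) (ω : Config E) :
    weight p ω = if ω = oneConfig p then 1 else 0 := by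
  unfold weight
  by_cases h : ω = oneConfig p
  · rw [if_pos h]
    refine Finset.prod_eq_one fun e _ => ?_
    rw [edgeFactor_of_pinned (hp e), h]
    simp [oneConfig]
  · rw [if_neg h]
    obtain ⟨e, he⟩ : ∃ e, ω e ≠ oneConfig p e := by
      by_contra hc
      push Not at hc
      exact h (funext hc)
    refine Finset.prod_eq_zero (Finset.mem_univ e) ?_
    rw [edgeFactor_of_pinned (hp e)]
    simp only [oneConfig] at he
    simp [he]

omit [IsStrictOrderedRing R] in
open Classical in
/-- Probabilities under a pinned vector are indicators at `oneConfig p`. -/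
lemma prob_of_pinned {p : E → R} (hp : Pinned p) (A : Set (Config E)) :
    prob p A = if oneConfig p ∈ A then 1 else 0 := by
  have hw : weight p = fun ω => if ω = oneConfig p then (1 : R) else 0 :=
    funext (weight_of_pinned hp)
  unfold prob
  rw [hw, Finset.sum_eq_single (oneConfig p)]
  · by_cases hA : oneConfig p ∈ A <;> simp [hA]
  · intro ω _ hω
    simp [Set.indicator_apply, hω]
  · intro h
    exact absurd (Finset.mem_univ _) h

end Pinned

/-! ## The base case: `(K′)` at a pinned weight vector -/

section Base

variable (ends : E → Sym2 V) (a₁ a₂ b v y : V)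

open Classical in
/-- **`(K′)` holds at every pinned weight vector** (a deterministic instance): a Boolean case
split on the seven connections that enter the form. -/
theorem kprimeHolds_of_pinned {p : E → R} (hp : Pinned p) : KPrimeHolds ends a₁ a₂ b v y p := by
  unfold KPrimeHolds kprimeForm
  simp only [prob_of_pinned hp]
  set ω := oneConfig p with hω
  have hO' : Conn ends ω a₂ a₁ ↔ Conn ends ω a₁ a₂ := ⟨conn_symm, conn_symm⟩
  simp only [Set.mem_inter_iff, mem_connEvent, mem_Ω, mem_N, mem_S, cls01e, cls01, Set.mem_union,
    Set.mem_compl_iff, hO']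
  by_cases hU : Conn ends ω a₁ v <;> by_cases hX : Conn ends ω a₁ b <;>
    by_cases hO : Conn ends ω a₁ a₂ <;> by_cases hS2 : Conn ends ω a₂ v <;>
    by_cases hW : Conn ends ω a₁ y <;> by_cases hY : Conn ends ω a₂ y <;>
    by_cases hXv : Conn ends ω v b <;> simp [hU, hX, hO, hS2, hW, hY, hXv]

end Base

/-! ## The induction -/

section Induction

variable (ends : E → Sym2 V) (a₁ a₂ b v y : V)

/-- **The edge induction**: if the one-edge Bernstein condition holds at every edge of every
admissible weight vector, `(K′)` holds for every admissible weight vector. -/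
theorem kprime_of_bernsteinStep_all
    (hall : ∀ p : E → R, IsProbVec p → ∀ e, BernsteinStepHolds ends a₁ a₂ b v y p e) :
    ∀ p : E → R, IsProbVec p → KPrimeHolds ends a₁ a₂ b v y p := by
  intro p
  induction' hn : unres p using Nat.strong_induction_on with n ih generalizing p
  intro hp
  by_cases hpin : Pinned p
  · exact kprimeHolds_of_pinned ends a₁ a₂ b v y hpin
  · simp only [Pinned, not_forall, not_or] at hpin
    obtain ⟨e, h0, h1⟩ := hpin
    have hlt0 : unres (Function.update p e 0) < n :=
      hn ▸ unres_update_lt h0 h1 (Or.inl rfl)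
    have hlt1 : unres (Function.update p e 1) < n :=
      hn ▸ unres_update_lt h0 h1 (Or.inr rfl)
    exact kprime_of_bernstein_step ends a₁ a₂ b v y p hp e
      (ih _ hlt0 _ rfl (hp.update e le_rfl zero_le_one))
      (ih _ hlt1 _ rfl (hp.update e zero_le_one le_rfl))
      (hall p hp e)

end Induction

end KPrime

end Summit.Ventures.PercRepro2
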